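/-
Copyright (c) 2026 the pub-hodgecm-mathlib formalisation cell (harness21).  Prover seat hodgecm-mathlib-A-p17 (g26), P6 «MOD programme»,
organ (ν5) of the G1c «ROOF REDUCTION» remainder, part 1 (bookkeeping); 2026-09-01.
-/
import Literature.AlgebraicGeometry.AbelianSchemes.AbelianSchemeFibreBaseChangeHom
import Literature.AlgebraicGeometry.Limits.SliceBaseChange
import Literature.RingTheory.Valuation.ValuationSubringHenselian
import Mathlib.RingTheory.IntegralClosure.IsIntegralClosure.Basic
import HarnessLib

/-!
# Transitivity bookkeeping for DESCEND-AND-EXTEND over a finite stage: five `pullbackFacObjIso`s compose to `fibreBaseChangeIso`;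
# the `Ω`-fibre of a stage extension; the refined stage lands in the valuation ring ([GortzWedhorn2020] (4.7); [NeukirchANT1999] II (4.8))

Topic `AlgebraicGeometry/AbelianSchemes`, namespace `Literature.AlgebraicGeometry.AbelianSchemes.AbelianSchemeOver`.  THEOREMS ONLY
(no definition, no named fact, no instance, no notation, no `sorry`).  Cell `hodgecm-mathlib` (D-0151), F0∕P6 «MOD», organ **(ν5)** of the
G1c «ROOF REDUCTION» remainder (A-p17 (g26) FINDING «G1c BASE IS NOT DEDEKIND», 2026-09-01), PART 1 — the generic bookkeeping consumed by
PART 2 `AbelianSchemeHomDescendExtendStage` (the one-call package «an `Ω̄`-homomorphism of geometric generic fibres extends over a finite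
refinement of the Dedekind stage»).

* §1 `facChain_eq_fibreBaseChangeIso` — for bases `i′ : S′ → S`, `η_L : P → S`, `η_{L′} : P′ → S′`, `s_{LL′} : P′ → P` over a common
  `b : P′ → S`, a field point `s_χ : Spec Ω → P′` (`a′ := s_χ ≫ η_{L′}`, `s_Ω := s_χ ≫ s_{LL′}`, `s_Ω ≫ η_L = a′ ≫ i′`) and an abelian scheme
  `Y → S`: the composite of the FIVE transitivity isomorphisms with explicit projections (★ `Limits.pullbackFacObjIso`)
  `(Y_{S′})_{a′} ≅ ((Y_{S′})_{P′})_Ω ≅ (Y_b)_Ω ≅ ((Y_P)_{P′})_Ω ≅ (Y_P)_Ω ≅ Y_{a′ ≫ i′}` IS ★ `fibreBaseChangeIso i′ a′` (Mathlib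
  `Over.pullbackComp`) on underlying `Ω`-morphisms — both commute with the two projections of `Y ×_S Spec Ω`;
* §1 `pullback_map_eq_of_facChain` — hence an `S′`-morphism `U : A_{S′} → C_{S′}` whose `P′`-fibre is the transported `F` whose `Ω`-fibre is
  the transported `u : A_{a′ ≫ i′} → C_{a′ ≫ i′}` (the shape of ★ `AbelianScheme.exists_stage_hom_baseChange_eq_of_algHom`'s spread clause:
  `srcFacIso`, `fibreFacIso` ARE `pullbackFacObjIso`) has `a′`-fibre `e_A ≫ u ≫ e_C⁻¹`;
* §2 `isDominant_specMap_of_injective` — `Spec` of an injective ring map is dominant;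
* §3 `exists_ringHom_integralClosure_valuationSubring` — for a valuation subring `R ⊆ Ω`, `h : D → R` over `L → Ω` and a stage
  `χ : L′ →ₐ[L] Ω`, the refined stage `integralClosure D L′` maps to `R` by `x ↦ χ x` (roots of monic polynomials over `R` lie in `R`).

HONEST LABEL: HC_CM is proved only modulo the cell's 2 remaining named inputs (hLiu418 24832, h413 24833) until rung 0 closes; generic capital on
`--supports stmt-HodgeConjecture-24832`, pays no letter.

## References
* [GortzWedhorn2020] U. Görtz, T. Wedhorn, *Algebraic Geometry I*, 2nd ed. (2020), Section (4.7), Prop. 4.16, Prop. 9.19.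
* [EGAIV3] A. Grothendieck, J. Dieudonné, EGA IV₃ (Publ. Math. IHÉS 28, 1966), Thm. 8.8.2 (i), 11.10.5.
* [NeukirchANT1999] J. Neukirch, *Algebraic Number Theory* (1999), Ch. II (4.8).
* [StacksProject] The Stacks Project, Tag 0ASP (valuation rings are integrally closed), Tag 01ZC.
-/

set_option autoImplicit false

noncomputable section

-- `(Over.pullback s).obj _`, `(A.baseChange s).X`, `(A.fibre s).toAbelianVariety.X` agree only above `instances` transparency (as in ★ (d1)–(d5)).
set_option backward.isDefEq.respectTransparency false

universe u

open CategoryTheory CategoryTheory.Limits AlgebraicGeometry Polynomial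
open scoped MonObj CategoryTheory.Obj
open Literature.AlgebraicGeometry.Motives (AbelianVariety)
open Literature.AlgebraicGeometry.Limits (pullbackFacObjIso pullbackFacObjIso_naturality pullbackFacObjIso_hom_left_fst
  pullbackFacObjIso_hom_left_fst_assoc pullbackFacObjIso_hom_left_snd)

namespace Literature.AlgebraicGeometry.AbelianSchemes

namespace AbelianSchemeOver

/-! ## §1 Five transitivity isomorphisms compose to `fibreBaseChangeIso`; the `Ω`-fibre of the extension -/

section FacChain

variable {S S' P P' : Scheme.{u}} {Ω : Type u} [Field Ω]
  (i' : S' ⟶ S) (ηL : P ⟶ S) (ηL' : P' ⟶ S') (sLL' : P' ⟶ P) (b : P' ⟶ S)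
  (hb₁ : ηL' ≫ i' = b) (hb₂ : sLL' ≫ ηL = b)
  (sχ : Spec (.of Ω) ⟶ P') (a' : Spec (.of Ω) ⟶ S') (hχ : sχ ≫ ηL' = a')
  (sΩ : Spec (.of Ω) ⟶ P) (hσ : sχ ≫ sLL' = sΩ) (ha : sΩ ≫ ηL = a' ≫ i')

/-- Base change along `s` commutes with the first projections (Mathlib `Over.pullback_map_left` + `pullback.lift_fst`). [folklore] -/
@[reassoc]
private theorem pb_map_fst {T T' : Scheme.{u}} (s : T' ⟶ T) {X Y : Over T} (g : X ⟶ Y) :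
    ((Over.pullback s).map g).left ≫ pullback.fst Y.hom s = pullback.fst X.hom s ≫ g.left := by
  simp only [Over.pullback_map_left, pullback.lift_fst]

/-- Bookkeeping: from `ε.hom.left ≫ p = q` to `ε.inv.left ≫ q = p` for an isomorphism `ε` in an over category. [folklore] -/
private theorem inv_left_comp {T : Scheme.{u}} {X Y : Over T} (ε : X ≅ Y) {Z : Scheme.{u}} (p : Y.left ⟶ Z)
    (q : X.left ⟶ Z) (h : ε.hom.left ≫ p = q) : ε.inv.left ≫ q = p := by
  rw [← h, ← Category.assoc, ← Over.comp_left, ε.inv_hom_id, Over.id_left, Category.id_comp]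

include hb₁ hb₂ hχ hσ ha

/-- **Five transitivity isomorphisms compose to ★ `fibreBaseChangeIso`.**  Bases `i′ : S′ → S`, `η_L : P → S`, `η_{L′} : P′ → S′`,
`s_{LL′} : P′ → P` over a common `b : P′ → S` (`η_{L′} ≫ i′ = b = s_{LL′} ≫ η_L`), and a field point `s_χ : Spec Ω → P′` with `a′ := s_χ ≫ η_{L′}`,
`s_Ω := s_χ ≫ s_{LL′}`, `s_Ω ≫ η_L = a′ ≫ i′` (think `S = Spec D`, `S′ = Spec D′`, `P = Spec L`, `P′ = Spec L′`).  For an abelian scheme `Y → S`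
the composite `(Y_{S′})_{a′} ≅ ((Y_{S′})_{P′})_Ω ≅ (Y_b)_Ω ≅ ((Y_P)_{P′})_Ω ≅ (Y_P)_Ω ≅ Y_{a′ ≫ i′}` of the transitivity isomorphisms with explicit
projections (★ `Limits.pullbackFacObjIso`) IS the underlying `Ω`-morphism of ★ `fibreBaseChangeIso i′ a′` (built on Mathlib's `Over.pullbackComp`):
both commute with the two projections of the fibre product `Y ×_S Spec Ω`. [cite: GortzWedhorn2020, Section (4.7), Prop. 4.16] -/
theorem facChain_eq_fibreBaseChangeIso (Y : AbelianSchemeOver S) :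
    (pullbackFacObjIso ηL' sχ a' hχ ((Over.pullback i').obj Y.X)).inv ≫
      (Over.pullback sχ).map (pullbackFacObjIso i' ηL' b hb₁ Y.X).hom ≫
      (Over.pullback sχ).map (pullbackFacObjIso ηL sLL' b hb₂ Y.X).inv ≫
      (pullbackFacObjIso sLL' sχ sΩ hσ ((Over.pullback ηL).obj Y.X)).hom ≫
      (pullbackFacObjIso ηL sΩ (a' ≫ i') ha Y.X).hom =
    (Y.fibreBaseChangeIso i' a').hom.hom.hom.hom := by
  ext : 1
  apply pullback.hom_ext
  · -- projections to `Y.X.left`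
    change _ = AbelianVariety.Hom.toSchemeHom (Y.fibreBaseChangeIso i' a').hom ≫ _
    rw [fibreBaseChangeIso_hom_toSchemeHom_fst]
    have e1 := inv_left_comp (pullbackFacObjIso ηL sLL' b hb₂ Y.X) _ _ (pullbackFacObjIso_hom_left_fst ηL sLL' b hb₂ Y.X)
    have e2 := inv_left_comp (pullbackFacObjIso ηL' sχ a' hχ ((Over.pullback i').obj Y.X)) _ _
      (pullbackFacObjIso_hom_left_fst ηL' sχ a' hχ ((Over.pullback i').obj Y.X))
    rw [Over.comp_left, Over.comp_left, Over.comp_left, Over.comp_left]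
    simp only [Category.assoc]
    rw [pullbackFacObjIso_hom_left_fst, pullbackFacObjIso_hom_left_fst_assoc, pb_map_fst_assoc, e1, pb_map_fst_assoc,
      pullbackFacObjIso_hom_left_fst]
    have e3 := congrArg (· ≫ pullback.fst Y.X.hom i') e2
    simp only [Category.assoc] at e3
    exact e3
  · -- projections to `Spec Ω`
    have w1 := Over.w ((pullbackFacObjIso ηL' sχ a' hχ ((Over.pullback i').obj Y.X)).inv ≫
      (Over.pullback sχ).map (pullbackFacObjIso i' ηL' b hb₁ Y.X).hom ≫
      (Over.pullback sχ).map (pullbackFacObjIso ηL sLL' b hb₂ Y.X).inv ≫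
      (pullbackFacObjIso sLL' sχ sΩ hσ ((Over.pullback ηL).obj Y.X)).hom ≫
      (pullbackFacObjIso ηL sΩ (a' ≫ i') ha Y.X).hom)
    have w2 := Over.w (Y.fibreBaseChangeIso i' a').hom.hom.hom.hom
    simp only [Over.pullback_obj_hom] at w1 w2
    erw [w1, w2]
    rfl

/-- **The `Ω`-fibre of the extension.**  In the situation of `facChain_eq_fibreBaseChangeIso`, let `U : A_{S′} → C_{S′}` be an `S′`-morphism
whose `P′`-fibre is the morphism `F : (A_P)_{P′} → (C_P)_{P′}` transported along the transitivity isomorphisms over `b`, and let the `Ω`-fibre of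
`F` (base change along `s_χ`) be the morphism `u : A_{a′ ≫ i′} → C_{a′ ≫ i′}` transported along the transitivity isomorphisms over `s_Ω` and
`a′ ≫ i′` (this is the shape of the spread clause of ★ `AbelianScheme.exists_stage_hom_baseChange_eq_of_algHom`: `srcFacIso`, `fibreFacIso` ARE
`pullbackFacObjIso`).  Then the `a′`-fibre of `U` is `u` conjugated by ★ `fibreBaseChangeIso`: `U_{a′} = e_A ≫ u ≫ e_C⁻¹` on underlying
`Ω`-morphisms. [cite: GortzWedhorn2020, Section (4.7), Prop. 4.16] [cite: EGAIV3, Thm. 8.8.2 (i)] -/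
theorem pullback_map_eq_of_facChain (A C : AbelianSchemeOver S)
    (U : (Over.pullback i').obj A.X ⟶ (Over.pullback i').obj C.X)
    (F : (Over.pullback sLL').obj ((Over.pullback ηL).obj A.X) ⟶ (Over.pullback sLL').obj ((Over.pullback ηL).obj C.X))
    (hU : (Over.pullback ηL').map U =
      (pullbackFacObjIso i' ηL' b hb₁ A.X).hom ≫ (pullbackFacObjIso ηL sLL' b hb₂ A.X).inv ≫ F ≫
        (pullbackFacObjIso ηL sLL' b hb₂ C.X).hom ≫ (pullbackFacObjIso i' ηL' b hb₁ C.X).inv)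
    (u : (Over.pullback (a' ≫ i')).obj A.X ⟶ (Over.pullback (a' ≫ i')).obj C.X)
    (hF : (Over.pullback sχ).map F =
      (pullbackFacObjIso sLL' sχ sΩ hσ ((Over.pullback ηL).obj A.X)).hom ≫
        ((pullbackFacObjIso ηL sΩ (a' ≫ i') ha A.X).hom ≫ u ≫ (pullbackFacObjIso ηL sΩ (a' ≫ i') ha C.X).inv) ≫
        (pullbackFacObjIso sLL' sχ sΩ hσ ((Over.pullback ηL).obj C.X)).inv) :
    (Over.pullback a').map U =
      (A.fibreBaseChangeIso i' a').hom.hom.hom.hom ≫ u ≫ (C.fibreBaseChangeIso i' a').inv.hom.hom.hom := by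
  have keyA := facChain_eq_fibreBaseChangeIso i' ηL ηL' sLL' b hb₁ hb₂ sχ a' hχ sΩ hσ ha A
  have keyC := facChain_eq_fibreBaseChangeIso i' ηL ηL' sLL' b hb₁ hb₂ sχ a' hχ sΩ hσ ha C
  have n := pullbackFacObjIso_naturality ηL' sχ a' hχ U
  have step1 : (Over.pullback a').map U =
      (pullbackFacObjIso ηL' sχ a' hχ ((Over.pullback i').obj A.X)).inv ≫
        (Over.pullback sχ).map ((Over.pullback ηL').map U) ≫ (pullbackFacObjIso ηL' sχ a' hχ ((Over.pullback i').obj C.X)).hom :=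
    (Iso.eq_inv_comp _).mpr n.symm
  rw [hU] at step1
  rw [step1]
  simp only [Functor.map_comp, hF, Category.assoc]
  rw [reassoc_of% keyA]
  congr 2
  -- the `C`-side composite is the inverse of the `C`-chain
  have hΘΨ : ((pullbackFacObjIso ηL' sχ a' hχ ((Over.pullback i').obj C.X)).inv ≫
      (Over.pullback sχ).map (pullbackFacObjIso i' ηL' b hb₁ C.X).hom ≫
      (Over.pullback sχ).map (pullbackFacObjIso ηL sLL' b hb₂ C.X).inv ≫
      (pullbackFacObjIso sLL' sχ sΩ hσ ((Over.pullback ηL).obj C.X)).hom ≫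
      (pullbackFacObjIso ηL sΩ (a' ≫ i') ha C.X).hom) ≫
      ((pullbackFacObjIso ηL sΩ (a' ≫ i') ha C.X).inv ≫
      (pullbackFacObjIso sLL' sχ sΩ hσ ((Over.pullback ηL).obj C.X)).inv ≫
      (Over.pullback sχ).map (pullbackFacObjIso ηL sLL' b hb₂ C.X).hom ≫
      (Over.pullback sχ).map (pullbackFacObjIso i' ηL' b hb₁ C.X).inv ≫
      (pullbackFacObjIso ηL' sχ a' hχ ((Over.pullback i').obj C.X)).hom) = 𝟙 _ := by
    simp only [Category.assoc, Iso.hom_inv_id_assoc, Iso.map_inv_hom_id_assoc, Iso.map_hom_inv_id_assoc, Iso.inv_hom_id]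
  rw [keyC] at hΘΨ
  have hinv : (C.fibreBaseChangeIso i' a').inv.hom.hom.hom ≫ (C.fibreBaseChangeIso i' a').hom.hom.hom.hom = 𝟙 _ := by
    change ((C.fibreBaseChangeIso i' a').inv ≫ (C.fibreBaseChangeIso i' a').hom).hom.hom.hom = _
    rw [Iso.inv_hom_id]
    rfl
  calc _ = ((C.fibreBaseChangeIso i' a').inv.hom.hom.hom ≫ (C.fibreBaseChangeIso i' a').hom.hom.hom.hom) ≫
        ((pullbackFacObjIso ηL sΩ (a' ≫ i') ha C.X).inv ≫
          (pullbackFacObjIso sLL' sχ sΩ hσ ((Over.pullback ηL).obj C.X)).inv ≫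
          (Over.pullback sχ).map (pullbackFacObjIso ηL sLL' b hb₂ C.X).hom ≫
          (Over.pullback sχ).map (pullbackFacObjIso i' ηL' b hb₁ C.X).inv ≫
          (pullbackFacObjIso ηL' sχ a' hχ ((Over.pullback i').obj C.X)).hom) := by rw [hinv, Category.id_comp]
    _ = (C.fibreBaseChangeIso i' a').inv.hom.hom.hom := by rw [Category.assoc, hΘΨ]; exact Category.comp_id _

end FacChain

/-! ## §2 `Spec` of an injective ring map is dominant -/

/-- `Spec` of an INJECTIVE ring map is dominant (the kernel, `0`, lies in the nilradical; Mathlib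
`PrimeSpectrum.denseRange_comap_iff_ker_le_nilRadical`). [cite: GortzWedhorn2020, Prop. 9.19] [cite: EGAIV3, 11.10.5] -/
theorem isDominant_specMap_of_injective {A B : Type u} [CommRing A] [CommRing B] (f : A →+* B)
    (hf : Function.Injective f) : IsDominant (Spec.map (CommRingCat.ofHom f)) := by
  constructor
  change DenseRange (PrimeSpectrum.comap f)
  rw [PrimeSpectrum.denseRange_comap_iff_ker_le_nilRadical, (RingHom.injective_iff_ker_eq_bot f).mp hf]
  exact bot_le

/-! ## §3 The refined stage lands in the valuation ring -/

/-- **The refined stage lands in the valuation ring.**  `R ⊆ Ω` a valuation subring, `h : D → R` over `L → Ω` (`h d = d` in `Ω`), `L′ ⊇ L` a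
field with `χ : L′ →ₐ[L] Ω`: every element of `D′ := integralClosure D L′` is a root of a monic polynomial over `D`, hence `χ` maps it to a
root of a monic polynomial over `R`, i.e. into `R` (a valuation ring is integrally closed in its fraction field, ★
`ValuationSubring.mem_of_isRoot_map_of_monic`); this is a ring map `h′ : D′ → R` with `h′ x = χ x` in `Ω` and `h′ ∘ (D → D′) = h`.
[cite: NeukirchANT1999, Ch. II (4.8)] [cite: StacksProject, Tag 0ASP] -/
theorem exists_ringHom_integralClosure_valuationSubring
    {D : Type u} [CommRing D] {L : Type u} [Field L] [Algebra D L]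
    {Ω : Type u} [Field Ω] [Algebra L Ω] (R : ValuationSubring Ω) (h : D →+* R)
    (hh : ∀ d, ((h d : R) : Ω) = algebraMap L Ω (algebraMap D L d))
    {L' : Type u} [Field L'] [Algebra L L'] [Algebra D L'] [IsScalarTower D L L'] (χ : L' →ₐ[L] Ω) :
    ∃ h' : integralClosure D L' →+* R,
      (∀ x, ((h' x : R) : Ω) = χ (x : L')) ∧ h'.comp (algebraMap D (integralClosure D L')) = h := by
  have hcomp : (χ.toRingHom).comp (algebraMap D L') = (algebraMap R Ω).comp h := by
    ext d
    change χ (algebraMap D L' d) = ((h d : R) : Ω)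
    rw [hh, IsScalarTower.algebraMap_apply D L L', AlgHom.commutes]
  have hmem : ∀ x : integralClosure D L', χ (x : L') ∈ R := by
    intro x
    obtain ⟨p, hp, hpx⟩ := x.2
    apply ValuationSubring.mem_of_isRoot_map_of_monic R (f := p.map h) (hp.map h)
    rw [Polynomial.map_map, ← hcomp, IsRoot.def, Polynomial.eval_map]
    have e := Polynomial.hom_eval₂ p (algebraMap D L') (χ : L' →+* Ω) (x : L')
    rw [hpx, map_zero] at e
    exact e.symm
  refine ⟨{ toFun := fun x => ⟨χ (x : L'), hmem x⟩
            map_one' := Subtype.ext (by simp)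
            map_mul' := fun a b => Subtype.ext (by simp)
            map_zero' := Subtype.ext (by simp)
            map_add' := fun a b => Subtype.ext (by simp) }, fun x => rfl, ?_⟩
  ext d
  change χ ((algebraMap D (integralClosure D L') d : integralClosure D L') : L') = ((h d : R) : Ω)
  rw [Subalgebra.coe_algebraMap]
  exact RingHom.congr_fun hcomp d


end AbelianSchemeOver

end Literature.AlgebraicGeometry.AbelianSchemes

end
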